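import Summits.ResolutionOfSingularities.ResolutionOfSingularities.Theorems.EquisingularLiftEquisingularLiftNatLinearCentrePoints
import Literature.AlgebraicGeometry.Motives.ProjectiveSpaceLinearSubspaces
import HarnessLib

/-!
# [OURS · L1 W4.5(b)] THE SUPPORT OF A COORDINATE LINEAR CENTRE IS ITS ZERO LOCUS: `supp ker Proj(f_k) = V₊(x_a : a ∉ range e)`, any `e`, any `n`
# (crux `Theses.EquisingularLift.EquisingularLiftNat`, stmt-ResolutionOfSingularities-20038)

NOT a statement of any manuscript; OURS kernel lemma (cell `res-hironaka`, chain w45b; seat res-D-pv-013, own initiative, counted 0). AI-written, weaker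
than expert review. No definition, no `sorry`, standard axioms.

For the kill map `f_k` of an injective `e : Fin (r+1) → Fin (N+1)` (…NatLinearCentreKill, p505223) the support of `Λ = ker Proj(f_k)` is EXACTLY the
coordinate linear subspace: `…NatLinearCentrePoints` (p506902) has `⊆` (`X_mem_asHomogeneousIdeal_of_mem_support`); here the converse, through the
generic point `coordSubspacePoint` of `V₊(x_a : a ∉ range e)` (tree `ProjectiveSpaceLinearSubspaces`: it IS `Proj(f_k)` of the point `(0)` of `ℙʳ_k`,
and its closure is the zero locus), so that off `supp Λ` some killed variable `x_a`, `a ∉ range e`, is invertible: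

* `LinearCentre.coordSubspacePoint_mem_range` — the generic point of `V₊(x_a : a ∉ range e)` lies in `range Proj(f_k)`;
* **`LinearCentre.support_ker_eq_zeroLocus`** — `supp Λ = {y | ∀ a ∉ range e, x_a ∈ 𝔭_y}`;
* `LinearCentre.exists_X_not_mem_of_not_mem_support` — `y ∉ supp Λ ⇒ ∃ a ∉ range e, x_a ∉ 𝔭_y` (the form consumed by
  `HypersurfaceSpecimen.isRegular_of_isBlowup_comap_of_charts_local`, p541657; the vertex case is `OrdPoint.exists_X_succ_not_mem_of_not_mem_support`).

References: Hartshorne II Prop. 2.5, Ex. 3.12 — through the cited tree files.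
-/

set_option linter.dupNamespace false -- mandated namespace `Summit.<Summit>.<Problem>` of this single-conjunct summit

noncomputable section

open CategoryTheory AlgebraicGeometry TopologicalSpace
open MvPolynomial HomogeneousLocalization
open Literature.AlgebraicGeometry.Motives Literature.AlgebraicGeometry.Motives.ProjectiveSpace
open AlgebraicGeometry.Scheme.IdealSheafData

attribute [local instance] MvPolynomial.gradedAlgebra

namespace Summit.ResolutionOfSingularities.ResolutionOfSingularities.Cruxes.EquisingularLiftNat

namespace LinearCentre

variable {k : Type} [Field k] {N r : ℕ} (e : Fin (r + 1) → Fin (N + 1)) (he : Function.Injective e)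
  (fk : (homogeneousSubmodule (Fin (N + 1)) k) →+*ᵍ (homogeneousSubmodule (Fin (r + 1)) k))
  (hfk' : HomogeneousIdeal.irrelevant (homogeneousSubmodule (Fin (r + 1)) k) ≤
    (HomogeneousIdeal.irrelevant (homogeneousSubmodule (Fin (N + 1)) k)).map fk)
  (hfkC : ∀ a : k, fk (C a) = C a) (hfke : ∀ j : Fin (r + 1), fk (X (e j)) = X j)
  (hfk0 : ∀ i : Fin (N + 1), i ∉ Set.range e → fk (X i) = 0)

/-- The complement of `range e` as a `Finset` is a proper subset (it misses `e 0`). [folklore] -/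
theorem filter_not_mem_range_ne_univ [DecidablePred fun a : Fin (N + 1) => a ∉ Set.range e] :
    (Finset.univ.filter fun a : Fin (N + 1) => a ∉ Set.range e) ≠ Finset.univ := by
  intro h
  have h0 := Finset.mem_univ (e 0)
  rw [← h, Finset.mem_filter] at h0
  exact h0.2 ⟨0, rfl⟩

include he hfkC hfke hfk0 in
/-- **The generic point of `V₊(x_a : a ∉ range e)` is `Proj(f_k)` of the point `(0)` of `ℙʳ_k`** (`ker f_k = (x_a : a ∉ range e)`). [folklore] -/
theorem coordSubspacePoint_mem_range [DecidablePred fun a : Fin (N + 1) => a ∉ Set.range e] :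
    coordSubspacePoint (k := k) (Finset.univ.filter fun a : Fin (N + 1) => a ∉ Set.range e) (filter_not_mem_range_ne_univ e) ∈
      Set.range (Proj.map fk hfk') := by
  -- the generic point `(0)` of `ℙʳ_k` (relevant: `x₀ ∉ (0)`)
  let y₀ : Proj (homogeneousSubmodule (Fin (r + 1)) k) :=
    ⟨⊥, Ideal.isPrime_bot, fun h => by
      have hX : (X 0 : MvPolynomial (Fin (r + 1)) k) ∈ HomogeneousIdeal.irrelevant (homogeneousSubmodule (Fin (r + 1)) k) :=
        HomogeneousIdeal.mem_irrelevant_of_mem _ zero_lt_one (isHomogeneous_X k 0)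
      have h0 : (X 0 : MvPolynomial (Fin (r + 1)) k) ∈ (⊥ : HomogeneousIdeal (homogeneousSubmodule (Fin (r + 1)) k)) := h hX
      rw [← HomogeneousIdeal.mem_iff, HomogeneousIdeal.toIdeal_bot, Ideal.mem_bot] at h0
      exact X_ne_zero (R := k) (0 : Fin (r + 1)) h0⟩
  refine ⟨y₀, ?_⟩
  apply ProjectiveSpectrum.ext
  apply HomogeneousIdeal.toIdeal_injective
  rw [projMap_apply_asHomogeneousIdeal, HomogeneousIdeal.toIdeal_comap, toIdeal_coordSubspacePoint]
  change Ideal.comap fk.toRingHom ⊥ = _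
  rw [← RingHom.ker_eq_comap_bot, ker_kill e he fk.toRingHom (fun a => hfkC a) (fun j => hfke j) (fun i hi => hfk0 i hi)]
  congr 1
  ext q
  constructor
  · rintro ⟨c, hc, rfl⟩
    exact ⟨c, Finset.mem_coe.mpr (Finset.mem_filter.mpr ⟨Finset.mem_univ _, hc⟩), rfl⟩
  · rintro ⟨c, hc, rfl⟩
    exact ⟨c, (Finset.mem_filter.mp (Finset.mem_coe.mp hc)).2, rfl⟩

include he hfkC hfke hfk0 in
/-- **`supp Λ = V₊(x_a : a ∉ range e)`** for `Λ = ker Proj(f_k)`: the support is closed and contains the generic point of the zero locus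
(`coordSubspacePoint_mem_range`, `closure_coordSubspacePoint`), and is contained in it (`X_mem_asHomogeneousIdeal_of_mem_support`).
[cite: Hartshorne1977, II Prop. 2.5 and Ex. 3.12 (a)] -/
theorem support_ker_eq_zeroLocus :
    ((Proj.map fk hfk').ker.support : Set (Proj (homogeneousSubmodule (Fin (N + 1)) k))) =
      {y | ∀ a : Fin (N + 1), a ∉ Set.range e → (X a : MvPolynomial (Fin (N + 1)) k) ∈ y.asHomogeneousIdeal} := by
  classical
  refine Set.Subset.antisymm (fun y hy a ha => X_mem_asHomogeneousIdeal_of_mem_support e fk hfk' hfkC hfke hfk0 hy ha) fun y hy => ?_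
  haveI : IsClosedImmersion (Proj.map fk hfk') := isClosedImmersion_projMap_kill e fk hfk' hfkC hfke
  have hycl : y ∈ closure {coordSubspacePoint (k := k) (Finset.univ.filter fun a : Fin (N + 1) => a ∉ Set.range e)
      (filter_not_mem_range_ne_univ e)} := by
    rw [closure_coordSubspacePoint]
    refine (ProjectiveSpectrum.mem_zeroLocus _ _ _).mpr ?_
    rintro _ ⟨c, hc, rfl⟩
    exact hy c (Finset.mem_filter.mp (Finset.mem_coe.mp hc)).2
  rw [support_ker_eq_range e fk hfk' hfkC hfke]
  exact closure_minimal (Set.singleton_subset_iff.mpr (coordSubspacePoint_mem_range e he fk hfk' hfkC hfke hfk0))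
    (Proj.map fk hfk').isClosedEmbedding.isClosed_range hycl

include he hfkC hfke hfk0 in
/-- **Off `supp Λ` some killed-direction variable is invertible**: `y ∉ supp Λ ⇒ ∃ a ∉ range e, x_a ∉ 𝔭_y`. [folklore] -/
theorem exists_X_not_mem_of_not_mem_support {y : Proj (homogeneousSubmodule (Fin (N + 1)) k)}
    (hy : y ∉ ((Proj.map fk hfk').ker.support : Set (Proj (homogeneousSubmodule (Fin (N + 1)) k)))) :
    ∃ a : Fin (N + 1), a ∉ Set.range e ∧ (X a : MvPolynomial (Fin (N + 1)) k) ∉ y.asHomogeneousIdeal := by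
  by_contra h
  push Not at h
  apply hy
  rw [support_ker_eq_zeroLocus e he fk hfk' hfkC hfke hfk0]
  exact fun a ha => h a ha

end LinearCentre

end Summit.ResolutionOfSingularities.ResolutionOfSingularities.Cruxes.EquisingularLiftNat

end
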